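import Summits.QuantumFields.BalabanUV.Beta.D1BFx.NeedleProjLetters
import Summits.QuantumFields.BalabanUV.Beta.D1BFx.GluonLegProfileD1

/-!
# `BalabanUV.Beta.D1BFx.NeedleProjLettersD1` — road «BF-x» for binder row D1, slot (K), END row `hGrp gN`, «GN-P LETTERS (d1)»: THE UNIT DIFFERENCE OF
# THE POINT VALUE OF `Ga` ON A PROJECTOR COLUMN GRADIENT, `|(Ga ∇_col P(·,q))(x + e_i) − (Ga ∇_col P(·,q))(x)| ≤ kC′∕n⁴ · e^{−δ₁·dist(blk x, blk q)}`
# (one power of `n` below the point value `kC∕n³` of `NeedleProjLetters`), from the FIRST-VARIABLE d1 block mass of the gluon leg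
# `Σ_{y∈B(β)} Σ_l |Ga (x+e_i) y − Ga x y| ≤ C′·n·e^{−δ′·dist(blk x, β)}` — the `Γ₁` ∕ `Φ₁` letter of the T₁ ∕ T₂ projector pieces («GN-P»)

HONEST DEPENDENCY (cell records, verbatim): «continuum YM on T⁴ ⇐ BetaPertH ∧ nine spine estimates (0/9 proved); BetaPertH ⇐ (D1) ∧ (D4) ∧
CAP+tail; G-an2-4 gates asym, D1 and NE2/3/4.»  HONEST FRAMING (cell contract, verbatim): «discharging `BetaPertH` makes Bałaban's UV stability
UNCONDITIONAL — a real constructive-QFT result; it is NOT the continuum limit and NOT the Clay problem.»  THIS MODULE DISCHARGES NOTHING of the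
wall: [folklore] counting inequalities MODULO [B5, Prop. 1.2] = `B5.Prop12Printed (fam nOf hn1 MOf a ha)` ∧ [B5, (1.126)–(1.127)] =
`B5.Kernel126_127Printed (kfam nOf MOf)` BY NAME — exactly where leaf-04-g9's d1 profile of the gluon leg (`GluonLegProfileD1.exists_abs_Ga_diff_left_le_profile`)
and the spread of `Ga` (`GluonLegTails.spr_Ga_of_prop12`) enter; composed with leaf-04's lattice HLS kit (`LatticeHLSRadial.sum_exp_div_nrm_pow_le`), the
block geometry (`B6QGQDecay237.dist_blk_ge`, `GhostLegBlockMass.dist_eq_supNorm`), the projector sup letter `ProjectorSupNorm.abs_Pgt_diff_le_sup`, the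
block resummation `NeedleRowLetters.tsum_eq_tsum_blocks` and `RProjector.abs_tsum_le_latticeConst`.  No `def`, no `def … : Prop`, nothing cited
beyond those two NAMED printed statements (hypotheses, never proved here), 0 sorry.  Root-level binders hW ∕ hR-sockets ∕ hSX-socket ∕ D1Tel ∕ D1Rep
— 0 discharged; (K) NOT closed; NOT D1, NOT `BetaPertH`, NOT continuum, NOT Clay.

ABSOLUTE RULE (cell charter, verbatim): «No internally-minted statement may enter as a cited fact. Every hypothesis is either kernel-proved in
this package or a verbatim quotation of a PUBLISHED theorem with page reference. The manuscript(s) under audit are NOT citable for their own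
disputed steps — they are the thing under adjudication; programme-internal (2001/route/tribunal) claims are never citable.»

WHY (owner records `HOME/b2b-balaban-beta-d1-p2/GLUON-NEEDLE-ROWS.md` v0.2 «GN-CELLS», row «T₁∕T₂ P-piece»; journal «GN-T12 ∕ FRAME» 11:33Z).  The frame
`LocalVertexForm.exists_SbT_outer_bound` bounds a T₁ piece by `K·(Φ₁Γ₀ + Φ₀Γ₁ + Φ₁Γ₁)` from window bounds of the two leg ENDS: values (`Φ₀`, `Γ₀`) and
FORWARD UNIT DIFFERENCES (`Φ₁`, `Γ₁`).  For the projector piece the column end is `Ga ∇_col P(·, b+e_ν)` (value `kC∕n³`, `NeedleProjLetters`) and this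
file supplies its unit difference `kC′∕n⁴` — the one letter of «GN-P» not yet in the tree.  The count: `|Ga(x+e_i, y) − Ga(x, y)| ≤ kG′e^{−(δ∕n)‖x−y‖}∕nrm³`
summed over a block of `n⁴` sites is `≍ n` near and `n·e^{−δ′D}` far (`sum_B_le_of_cube_profile`, the generic form of leaf-04-g9's
`exists_sum_B_abs_Ga_diff_le`, which sums the OTHER variable), against `|∇P| ≤ cPPs·n⁻⁵·e^{−δ_PP·d}`: `n·n⁻⁵ = n⁻⁴` per block, resummed with `K₄`.
* §1 [folklore] **`sum_B_le_of_cube_profile`** (generic: a scale-`n` damped inverse-cube profile summed over one block `≤ k·e^{δ∕2}(217 + 864∕δ)·n·e^{−(δ∕2)·dist}`).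
* §2 [folklore] **`exists_sum_B_sum_abs_Ga_diff_first_le`** (the first-variable d1 block mass of `Ga`, fibre-summed: `C′·n·e^{−δ′·dist(blk x, β)}`).
* §3 [folklore] `applyK_sub_eq_tsum`, **`exists_applyK_colGrad_diff_le`** (kC′: `|Δ_i (Ga ∇_col P(·,q))(x)| ≤ kC′∕n⁴·e^{−δ₁·dist(blk x, blk q)}`),
  **`exists_applyKT_rowGrad_diff_le`** (transposed placement, by `applyKT_rowGrad_eq`).
NOT HERE (honest): the cell; the (1.22) sum.  Unit `b2b-balaban-beta-d1-p2` (gen 10), road «BF-x» OWNER; `LEAVES-BFx.md` row (N) «GN-P LETTERS (d1)».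
-/

namespace Summit.QuantumFields.BalabanUV.Beta.D1BFx.NeedleProjLettersD1

open Finset Real
open scoped BigOperators
open Literature.MathematicalPhysics.QuantumFieldTheory.Balaban1983to89
open Literature.MathematicalPhysics.QuantumFieldTheory.Balaban1983to89.Beta
open B12Sec2to5 (l1 l1_nonneg)
open B4Sect5Proof (latticeConst latticeConst_nonneg)
open B6QGQLower276 (X e blk B mem_B)
open B6QGQDecay237 (dist_blk_ge)
open ExpKernelCalculus (Site MKer Decays summable_exp_shift)
open DyadicShell (Pt)
open AffineAveraging (unitVec)
open VectorTailsLoc (fam kfam)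
open PoissonInterior (nrm nrm_pos one_le_nrm nrm_neg supNorm supNorm_neg)
open Summit.QuantumFields.BalabanUV.Beta.TameKernelCalculus (Spr)
open Summit.QuantumFields.BalabanUV.Beta.D1BFx.RProjector (Pgt Pgt_symm abs_tsum_le_latticeConst deltaPP deltaPP_pos)
open Summit.QuantumFields.BalabanUV.Beta.D1BFx.ProjectorSupNorm (cPPs cPPs_nonneg abs_Pgt_diff_le_sup)
open Summit.QuantumFields.BalabanUV.Beta.D1BFx.NeedleRowLetters (tsum_eq_tsum_blocks)
open Summit.QuantumFields.BalabanUV.Beta.D1BFx.GluonLeg (Ga Ga_apply Ga_symm)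
open Summit.QuantumFields.BalabanUV.Beta.D1BFx.GluonLegTails (spr_Ga_of_prop12)
open Summit.QuantumFields.BalabanUV.Beta.D1BFx.FrozenLegTails (nOf MOf hn1)
open Summit.QuantumFields.BalabanUV.Beta.D1BFx.GhostLeg (cast_pred_add_one)
open Summit.QuantumFields.BalabanUV.Beta.D1BFx.GhostLegBlockMass (dist_eq_supNorm)
open Summit.QuantumFields.BalabanUV.Beta.D1BFx.LatticeHLSProfiles (supNorm_dyadic)
open Summit.QuantumFields.BalabanUV.Beta.D1BFx.LatticeHLSRadial (sum_exp_div_nrm_pow_le)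
open Summit.QuantumFields.BalabanUV.Beta.D1BFx.GluonLegProfileD1 (exists_abs_Ga_diff_left_le_profile)
open Summit.QuantumFields.BalabanUV.Beta.D1BFx.RankOneBubble (applyK applyKT applyK_apply applyKT_apply)
open Summit.QuantumFields.BalabanUV.Beta.D1BFx.RankOneBubbleJets (colGrad rowGrad)
open Summit.QuantumFields.BalabanUV.Beta.D1BFx.NeedleProjLetters (exp_blocks_le unitVec_eq_e' applyKT_rowGrad_eq)

noncomputable section

variable (a : ℝ) (ha : 0 < a)

/-! ## §1 A scale-`n` damped inverse-cube profile summed over one block -/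

/-- [folklore] **A DAMPED INVERSE-CUBE PROFILE CENTRED AT `t`, SUMMED OVER ONE BLOCK**: if `|h y| ≤ k·e^{−(δ∕n)‖y−t‖∞}∕nrm(y−t)³` on `B (n−1) β`, then
`Σ_{y∈B β} |h y| ≤ k·e^{δ∕2}·(217 + 864∕δ)·n·e^{−(δ∕2)·dist(blk (n−1) t, β)}` (half the damping pays the block distance via `dist_blk_ge`; the radial
sum at `p = 3 = d − 1` is `≍ n` by `sum_exp_div_nrm_pow_le`) — the generic form of leaf-04-g9's `exists_sum_B_abs_Ga_diff_le`. -/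
theorem sum_B_le_of_cube_profile {n : ℕ} [NeZero n] {h : Pt → ℝ} {k δ : ℝ} (hk : 0 ≤ k) (hδ : 0 < δ) (t β : Pt)
    (hh : ∀ y ∈ B (n - 1) β, |h y| ≤ k * Real.exp (-(δ / n) * supNorm (d := 4) (y - t)) / nrm (d := 4) (y - t) ^ 3) :
    ∑ y ∈ B (n - 1) β, |h y| ≤ k * Real.exp (δ / 2) * (217 + 864 / δ) * n * Real.exp (-(δ / 2 * dist (blk (n - 1) t) β)) := by
  have hn : (0 : ℝ) < n := by exact_mod_cast Nat.pos_of_ne_zero (NeZero.ne n)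
  set m : ℕ := n - 1 with hm
  have hmn : ((m : ℝ) + 1) = n := cast_pred_add_one n
  set D : ℝ := dist (blk m t) β with hD
  have ht : t ∈ B m (blk m t) := mem_B.2 rfl
  have hterm : ∀ y ∈ B m β, |h y| ≤ k * Real.exp (δ / 2) * Real.exp (-(δ / 2 * D)) *
      (Real.exp (-(δ / 2 / n) * supNorm (d := 4) (y - t)) / nrm (d := 4) (y - t) ^ 3) := by
    intro y hy
    refine (hh y hy).trans ?_
    have hnrm := nrm_pos (d := 4) (y - t)
    have hlow : (n : ℝ) * D - m ≤ (supNorm (d := 4) (y - t) : ℝ) := by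
      have h1 := dist_blk_ge ht hy
      rw [hmn, dist_eq_supNorm t y] at h1
      have e1 : DyadicShell.supNorm (t - y) = supNorm (d := 4) (y - t) := by
        rw [supNorm_dyadic, show t - y = -(y - t) by abel, supNorm_neg]
      rw [e1] at h1
      exact h1
    have hmle : (m : ℝ) ≤ n := by linarith
    have hsplit : Real.exp (-(δ / n) * supNorm (d := 4) (y - t)) =
        Real.exp (-(δ / 2 / n) * supNorm (d := 4) (y - t)) * Real.exp (-(δ / 2 / n) * supNorm (d := 4) (y - t)) := by
      rw [← Real.exp_add]; congr 1; ring
    have hhalf : Real.exp (-(δ / 2 / n) * supNorm (d := 4) (y - t)) ≤ Real.exp (δ / 2) * Real.exp (-(δ / 2 * D)) := by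
      rw [← Real.exp_add]
      apply Real.exp_le_exp.mpr
      have h2 : δ / 2 / n * ((n : ℝ) * D - m) ≤ δ / 2 / n * supNorm (d := 4) (y - t) := mul_le_mul_of_nonneg_left hlow (by positivity)
      have e2 : δ / 2 / n * ((n : ℝ) * D - m) = δ / 2 * D - δ / 2 * (m / n) := by field_simp
      have h3 : δ / 2 * ((m : ℝ) / n) ≤ δ / 2 := by
        have : (m : ℝ) / n ≤ 1 := by rw [div_le_one hn]; exact hmle
        nlinarith
      nlinarith
    rw [hsplit]
    calc k * (Real.exp (-(δ / 2 / n) * supNorm (d := 4) (y - t)) * Real.exp (-(δ / 2 / n) * supNorm (d := 4) (y - t))) / nrm (d := 4) (y - t) ^ 3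
        ≤ k * (Real.exp (δ / 2) * Real.exp (-(δ / 2 * D)) * Real.exp (-(δ / 2 / n) * supNorm (d := 4) (y - t))) / nrm (d := 4) (y - t) ^ 3 := by
          gcongr
      _ = _ := by ring
  have hkit := sum_exp_div_nrm_pow_le (d := 4) (by norm_num) (ε := δ / 2 / n) (by positivity) (p := 3) (by norm_num) (B m β) t
  have hkit' : ∑ y ∈ B m β, Real.exp (-(δ / 2 / n) * supNorm (d := 4) (y - t)) / nrm (d := 4) (y - t) ^ 3 ≤ (217 + 864 / δ) * n := by
    refine hkit.trans ?_
    have e2 : (1 : ℝ) + 2 * (4 : ℕ) * 3 ^ (4 - 1) * (((4 - 1 - 3 : ℕ).factorial : ℝ) * (2 / (δ / 2 / n)) ^ (4 - 1 - 3) * (1 + 2 / (δ / 2 / n)))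
        = 217 + 864 / δ * n := by
      rw [show (4 : ℕ) - 1 - 3 = 0 by norm_num, Nat.factorial_zero, pow_zero, Nat.cast_one, one_mul]
      field_simp
      ring
    rw [e2]
    have e3 : (217 + 864 / δ) * (n : ℝ) = 217 * n + 864 / δ * n := by ring
    rw [e3]
    have hn1 : (1 : ℝ) ≤ n := by exact_mod_cast NeZero.one_le
    nlinarith
  calc ∑ y ∈ B m β, |h y|
      ≤ ∑ y ∈ B m β, k * Real.exp (δ / 2) * Real.exp (-(δ / 2 * D)) *
          (Real.exp (-(δ / 2 / n) * supNorm (d := 4) (y - t)) / nrm (d := 4) (y - t) ^ 3) := Finset.sum_le_sum hterm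
    _ = k * Real.exp (δ / 2) * Real.exp (-(δ / 2 * D)) *
          ∑ y ∈ B m β, Real.exp (-(δ / 2 / n) * supNorm (d := 4) (y - t)) / nrm (d := 4) (y - t) ^ 3 := by rw [Finset.mul_sum]
    _ ≤ k * Real.exp (δ / 2) * Real.exp (-(δ / 2 * D)) * ((217 + 864 / δ) * n) := mul_le_mul_of_nonneg_left hkit' (by positivity)
    _ = k * Real.exp (δ / 2) * (217 + 864 / δ) * n * Real.exp (-(δ / 2 * D)) := by ring

/-! ## §2 The first-variable d1 block mass of the gluon leg -/

/-- [folklore] **THE FIRST-VARIABLE d1 BLOCK MASS OF `Ga`, FIBRE-SUMMED, MODULO [B5, Prop. 1.2] ∧ [B5, (1.126)–(1.127)] BY NAME**: one `C′ ≥ 0`, `δ′ > 0`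
with `Σ_{y∈B (n−1) β} Σ_l |Ga n a (x + e_i) y α l − Ga n a x y α l| ≤ C′·n·e^{−δ′·dist(blk (n−1) x, β)}` for all `n ≥ 1`, `x`, `β`, `α`, `i`
(leaf-04-g9's left d1 profile `kG′e^{−(δ∕n)‖x−y‖}∕nrm(x−y)³` summed over the block by §1). -/
theorem exists_sum_B_sum_abs_Ga_diff_first_le (h12 : B5.Prop12Printed (fam nOf hn1 MOf a ha)) (h126 : B5.Kernel126_127Printed (kfam nOf MOf)) :
    ∃ C δ' : ℝ, 0 < δ' ∧ 0 ≤ C ∧ ∀ (n : ℕ) [NeZero n] (x β : Pt) (α i : Fin 4),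
      ∑ y ∈ B (n - 1) β, ∑ l : Fin 4, |Ga n a (x + unitVec i) y α l - Ga n a x y α l|
        ≤ C * (n : ℝ) * Real.exp (-(δ' * dist (blk (n - 1) x) β)) := by
  obtain ⟨kG', δ, hδ, hk, h⟩ := exists_abs_Ga_diff_left_le_profile a ha h12 h126
  refine ⟨4 * kG' * Real.exp (δ / 2) * (217 + 864 / δ), δ / 2, by positivity, by positivity, fun n _ x β α i => ?_⟩
  have hprof : ∀ y ∈ B (n - 1) β, |(∑ l : Fin 4, |Ga n a (x + unitVec i) y α l - Ga n a x y α l|)|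
      ≤ 4 * kG' * Real.exp (-(δ / n) * supNorm (d := 4) (y - x)) / nrm (d := 4) (y - x) ^ 3 := by
    intro y _
    rw [abs_of_nonneg (sum_nonneg fun l _ => abs_nonneg _)]
    have e1 : supNorm (d := 4) (x - y) = supNorm (d := 4) (y - x) := by rw [show x - y = -(y - x) by abel, supNorm_neg]
    have e2 : nrm (d := 4) (x - y) = nrm (d := 4) (y - x) := by rw [show x - y = -(y - x) by abel, nrm_neg]
    calc ∑ l : Fin 4, |Ga n a (x + unitVec i) y α l - Ga n a x y α l|
        ≤ ∑ _l : Fin 4, kG' * Real.exp (-(δ / n) * supNorm (d := 4) (y - x)) / nrm (d := 4) (y - x) ^ 3 :=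
          Finset.sum_le_sum fun l _ => by have := h n x y α l i; rwa [e1, e2] at this
      _ = _ := by rw [Finset.sum_const, Finset.card_univ, Fintype.card_fin, nsmul_eq_mul]; push_cast; ring
  have := sum_B_le_of_cube_profile (h := fun y => ∑ l : Fin 4, |Ga n a (x + unitVec i) y α l - Ga n a x y α l|)
    (by positivity : (0 : ℝ) ≤ 4 * kG') hδ x β hprof
  refine (le_of_eq ?_).trans (this.trans (le_of_eq (by ring)))
  exact (Finset.sum_congr rfl fun y _ => (abs_of_nonneg (sum_nonneg fun l _ => abs_nonneg _))).symm

/-! ## §3 (kC′) The unit difference of the point value of `Ga` on a projector column gradient -/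

/-- [folklore] the difference of two applications of bond kernels is the application of the difference, termwise summable case. -/
theorem applyK_sub_eq_tsum {A A' : MKer 4 (Fin 4)} {φ : Pt → Fin 4 → ℝ} (x x' : Pt) (α : Fin 4)
    (h : Summable fun y : Pt => ∑ b, A x y α b * φ y b) (h' : Summable fun y : Pt => ∑ b, A' x' y α b * φ y b) :
    applyK A φ x α - applyK A' φ x' α = ∑' y : Pt, ∑ b, (A x y α b - A' x' y α b) * φ y b := by
  rw [applyK_apply, applyK_apply, ← h.tsum_sub h']
  refine tsum_congr fun y => ?_
  rw [← Finset.sum_sub_distrib]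
  exact Finset.sum_congr rfl fun b _ => by ring

/-- [folklore] **(kC′) THE UNIT DIFFERENCE OF THE POINT VALUE OF `Ga` ON A PROJECTOR COLUMN GRADIENT IS `O(n⁻⁴)` WITH BLOCK DECAY**, modulo
[B5, Prop. 1.2] ∧ [B5, (1.126)–(1.127)] BY NAME: one `kC′ ≥ 0`, `δ₁ > 0` with
`|applyK (Ga n a) (colGrad (Pgt n a) q) (x + e_i) α − applyK (Ga n a) (colGrad (Pgt n a) q) x α| ≤ kC′∕n⁴·e^{−δ₁·dist(blk (n−1) x, blk (n−1) q)}`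
for all `n ≥ 1`, `q`, `x`, `α`, `i` (§2's mass `C′n` per block against `|∇P| ≤ cPPs·n⁻⁵·e^{−δ_PP d}`, resummed with `K₄`). -/
theorem exists_applyK_colGrad_diff_le (h12 : B5.Prop12Printed (fam nOf hn1 MOf a ha)) (h126 : B5.Kernel126_127Printed (kfam nOf MOf)) :
    ∃ kC' δ₁ : ℝ, 0 < δ₁ ∧ 0 ≤ kC' ∧ ∀ (n : ℕ) [NeZero n] (q x : Pt) (α i : Fin 4),
      |applyK (Ga n a) (colGrad (Pgt n a) q) (x + unitVec i) α - applyK (Ga n a) (colGrad (Pgt n a) q) x α|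
        ≤ kC' / (n : ℝ) ^ 4 * Real.exp (-(δ₁ * dist (blk (n - 1) x) (blk (n - 1) q))) := by
  obtain ⟨C₁, δ₁, hδ₁, hC₁, hmass⟩ := exists_sum_B_sum_abs_Ga_diff_first_le a ha h12 h126
  have hPP := deltaPP_pos 4 ha
  have hcP := cPPs_nonneg 4 ha
  refine ⟨C₁ * cPPs 4 a * latticeConst 4 (δ₁ / 2), min δ₁ (deltaPP 4 a) / 2, by positivity,
    by have := latticeConst_nonneg 4 (half_pos hδ₁).le; positivity, fun n _ q x α i => ?_⟩
  have hn : (0 : ℝ) < n := by exact_mod_cast Nat.pos_of_ne_zero (NeZero.ne n)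
  set m : ℕ := n - 1 with hm
  -- the difference kernel and the summand
  set dG : Pt → Fin 4 → ℝ := fun y β => Ga n a (x + unitVec i) y α β - Ga n a x y α β with hdG
  set F : Pt → ℝ := fun y => ∑ β : Fin 4, dG y β * colGrad (Pgt n a) q y β with hF
  -- the projector difference letter, block form
  have hP : ∀ (y : Pt) (β : Fin 4), |colGrad (Pgt n a) q y β|
      ≤ cPPs 4 a / (n : ℝ) ^ 5 * Real.exp (-(deltaPP 4 a * dist (blk m y) (blk m q))) := fun y β => by
    show |Pgt n a (y + unitVec β) q () () - Pgt n a y q () ()| ≤ _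
    rw [unitVec_eq_e']; exact abs_Pgt_diff_le_sup n ha y q β () ()
  have hP' : ∀ (y : Pt) (β : Fin 4), |colGrad (Pgt n a) q y β| ≤ cPPs 4 a / (n : ℝ) ^ 5 := fun y β =>
    (hP y β).trans (mul_le_of_le_one_right (by positivity) (by
      rw [Real.exp_le_one_iff]; have : 0 ≤ deltaPP 4 a * dist (blk m y) (blk m q) := by positivity
      linarith))
  -- summability of the two applications (spread leg × bounded difference) and the difference as one series
  obtain ⟨C, δ, hδ, hGa⟩ := spr_Ga_of_prop12 (a := a) (ha := ha) h12 h126 n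
  have hC0 : 0 ≤ C := hGa.nonneg α
  have hsumAt : ∀ x₀ : Pt, Summable fun y : Pt => ∑ β : Fin 4, Ga n a x₀ y α β * colGrad (Pgt n a) q y β := by
    intro x₀
    refine Summable.of_norm_bounded (g := fun y => ∑ _β : Fin 4, C * Real.exp (-δ * l1 (x₀ - y)) * (cPPs 4 a / (n : ℝ) ^ 5)) ?_ fun y => ?_
    · exact summable_sum fun β _ => ((summable_exp_shift hδ x₀).mul_left C).mul_right _
    · rw [Real.norm_eq_abs]
      refine (Finset.abs_sum_le_sum_abs _ _).trans (Finset.sum_le_sum fun β _ => ?_)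
      rw [abs_mul]
      exact mul_le_mul (hGa x₀ y α β) (hP' y β) (abs_nonneg _) (by positivity)
  have happ : applyK (Ga n a) (colGrad (Pgt n a) q) (x + unitVec i) α - applyK (Ga n a) (colGrad (Pgt n a) q) x α = ∑' y, F y := by
    rw [applyK_sub_eq_tsum (φ := colGrad (Pgt n a) q) (x + unitVec i) x α (hsumAt _) (hsumAt _)]
  -- pointwise bound of the summand
  have hFle : ∀ y, |F y| ≤ (∑ β : Fin 4, |dG y β|) * (cPPs 4 a / (n : ℝ) ^ 5 * Real.exp (-(deltaPP 4 a * dist (blk m y) (blk m q)))) := by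
    intro y
    calc |F y| ≤ ∑ β : Fin 4, |dG y β * colGrad (Pgt n a) q y β| := Finset.abs_sum_le_sum_abs _ _
      _ ≤ ∑ β : Fin 4, |dG y β| * (cPPs 4 a / (n : ℝ) ^ 5 * Real.exp (-(deltaPP 4 a * dist (blk m y) (blk m q)))) :=
          Finset.sum_le_sum fun β _ => by rw [abs_mul]; exact mul_le_mul_of_nonneg_left (hP y β) (abs_nonneg _)
      _ = _ := by rw [Finset.sum_mul]
  have hsum : Summable F := by
    refine ((hsumAt (x + unitVec i)).sub (hsumAt x)).congr fun y => ?_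
    show (∑ β : Fin 4, Ga n a (x + unitVec i) y α β * colGrad (Pgt n a) q y β) - (∑ β : Fin 4, Ga n a x y α β * colGrad (Pgt n a) q y β) = F y
    rw [hF, ← Finset.sum_sub_distrib]
    exact Finset.sum_congr rfl fun β _ => by rw [hdG]; ring
  rw [happ, tsum_eq_tsum_blocks m hsum]
  -- the block bound
  have hdxq : 0 ≤ dist (blk m x) (blk m q) := dist_nonneg
  set M : ℝ := C₁ * cPPs 4 a / (n : ℝ) ^ 4 * Real.exp (-(min δ₁ (deltaPP 4 a) / 2 * dist (blk m x) (blk m q))) with hM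
  have hM0 : 0 ≤ M := by positivity
  have hblk : ∀ w' : X 4, |∑ y ∈ B m w', F y| ≤ M * Real.exp (-(δ₁ / 2 * dist (blk m x) w')) := by
    intro w'
    have h1 : |∑ y ∈ B m w', F y| ≤ (∑ y ∈ B m w', ∑ β : Fin 4, |dG y β|) *
        (cPPs 4 a / (n : ℝ) ^ 5 * Real.exp (-(deltaPP 4 a * dist w' (blk m q)))) := by
      calc |∑ y ∈ B m w', F y| ≤ ∑ y ∈ B m w', |F y| := Finset.abs_sum_le_sum_abs _ _
        _ ≤ ∑ y ∈ B m w', (∑ β : Fin 4, |dG y β|) * (cPPs 4 a / (n : ℝ) ^ 5 * Real.exp (-(deltaPP 4 a * dist w' (blk m q)))) :=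
            Finset.sum_le_sum fun y hy => by have h := hFle y; rwa [mem_B.1 hy] at h
        _ = _ := by rw [Finset.sum_mul]
    have h2 : ∑ y ∈ B m w', ∑ β : Fin 4, |dG y β| ≤ C₁ * (n : ℝ) * Real.exp (-(δ₁ * dist (blk m x) w')) := hmass n x w' α i
    have hd1 : 0 ≤ dist (blk m x) w' := dist_nonneg
    have hd2 : 0 ≤ dist w' (blk m q) := dist_nonneg
    have htri : dist (blk m x) (blk m q) ≤ dist (blk m x) w' + dist w' (blk m q) := dist_triangle _ _ _
    have hexp := exp_blocks_le hδ₁.le hPP.le hd1 hd2 htri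
    calc |∑ y ∈ B m w', F y|
        ≤ (C₁ * (n : ℝ) * Real.exp (-(δ₁ * dist (blk m x) w'))) * (cPPs 4 a / (n : ℝ) ^ 5 * Real.exp (-(deltaPP 4 a * dist w' (blk m q)))) :=
          h1.trans (mul_le_mul_of_nonneg_right h2 (by positivity))
      _ = C₁ * cPPs 4 a / (n : ℝ) ^ 4 * (Real.exp (-(δ₁ * dist (blk m x) w')) * Real.exp (-(deltaPP 4 a * dist w' (blk m q)))) := by
          field_simp
      _ ≤ C₁ * cPPs 4 a / (n : ℝ) ^ 4 *
            (Real.exp (-(min δ₁ (deltaPP 4 a) / 2 * dist (blk m x) (blk m q))) * Real.exp (-(δ₁ / 2 * dist (blk m x) w'))) :=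
          mul_le_mul_of_nonneg_left hexp (by positivity)
      _ = M * Real.exp (-(δ₁ / 2 * dist (blk m x) w')) := by rw [hM]; ring
  refine (abs_tsum_le_latticeConst (half_pos hδ₁) hM0 (blk m x) hblk).trans (le_of_eq ?_)
  rw [hM]; ring

/-- [folklore] **(kC′), TRANSPOSED PLACEMENT**: the same bound for the unit differences of `applyKT (rowGrad (Pgt n a) p) (Ga n a)`
(`NeedleProjLetters.applyKT_rowGrad_eq`). -/
theorem exists_applyKT_rowGrad_diff_le (h12 : B5.Prop12Printed (fam nOf hn1 MOf a ha)) (h126 : B5.Kernel126_127Printed (kfam nOf MOf)) :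
    ∃ kC' δ₁ : ℝ, 0 < δ₁ ∧ 0 ≤ kC' ∧ ∀ (n : ℕ) [NeZero n] (p z : Pt) (β i : Fin 4),
      |applyKT (rowGrad (Pgt n a) p) (Ga n a) (z + unitVec i) β - applyKT (rowGrad (Pgt n a) p) (Ga n a) z β|
        ≤ kC' / (n : ℝ) ^ 4 * Real.exp (-(δ₁ * dist (blk (n - 1) z) (blk (n - 1) p))) := by
  obtain ⟨kC', δ₁, hδ₁, hk, h⟩ := exists_applyK_colGrad_diff_le a ha h12 h126
  exact ⟨kC', δ₁, hδ₁, hk, fun n _ p z β i => by rw [applyKT_rowGrad_eq a ha n p]; exact h n p z β i⟩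

end

end Summit.QuantumFields.BalabanUV.Beta.D1BFx.NeedleProjLettersD1
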